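import Literature.AlgebraicGeometry.Resolution.NodalPowRingSingularLocus
import Literature.AlgebraicGeometry.Resolution.RegularHomRegularLocus
import Literature.AlgebraicGeometry.Resolution.QuasiExcellentField
import Literature.AlgebraicGeometry.Resolution.AlterationsSemiStableResolution
import HarnessLib

/-!
# De Jong 1996, 3.5, "`nᵢ ∈ {0, 1}`": `DeJong1996CodimThreeExponentsLeOne` from the G-ring leaf

Topic: `Literature/AlgebraicGeometry/Resolution`. The named fact
`DeJong1996CodimThreeExponentsLeOne` (`AlterationsCodimThreeNodalFormParts.lean`; de Jong 1996,
3.5, first sentence: for a pair in Situation 4.23 with `codim(Sing(X), X) ≥ 3`, every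
presentation `𝒪̂_{X,x} ≅ k⟦u, v, t₁, …, t_m⟧/(uv - ∏ⱼ tⱼ^{nnⱼ})` at a closed point has all
`nnⱼ ≤ 1`) is PROVED here from the single standard leaf `Matsumura1987_32_polynomial`
(`ExcellentRings.lean`: polynomial rings over a field are G-rings; Matsumura, Cor. of Thm. 32.6),
along de Jong's argument ("In the equations above `X` is singular along
`u = v = t₁ = t₂ = 0`", 3.5; "The integer `nᵢ` must be `≥ 2`, otherwise `X` is regular along the
generic point of `T`", 3.4):

1. if `nnᵢ ≥ 2`, the formal model `B = k⟦u, v, t⟧/(F)` has the prime `𝔓 = (u, v, tᵢ)/(F)` with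
   `B_𝔓` not regular and `dim B_𝔓 ≤ 2`
   (`DeJong1996.exists_prime_nodalPowRing_not_isRegularLocalRing`,
   `NodalPowRingSingularLocus.lean`);
2. the local rings of the `k`-scheme of finite type `X` are G-rings (the leaf, with "a
   localisation of a G-ring is a G-ring", `isGRing_of_isLocalization`), so the regular locus of
   `Spec 𝒪̂_{X,x}` is the inverse image of that of `Spec 𝒪_{X,x}` and heights do not increase
   under contraction (EGA IV₂ 7.8.3 (v);
   `IsGRing.isRegularLocalRing_localization_adicCompletion_iff`, `RegularHomRegularLocus.lean`);
3. the contraction `𝔭` of `𝔓` to `𝒪_{X,x}` is the local ring of a point `x'` of `X`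
   (generising `x`) which is singular of dimension `≤ 2`, contradicting
   `codim(Sing(X), X) ≥ 3`.

* `DeJong1996CodimThreeExponentsLeOne.of_polynomial : Matsumura1987_32_polynomial →
  DeJong1996CodimThreeExponentsLeOne`.

## Sources

* A. J. de Jong, *Smoothness, semi-stability and alterations*, Publ. Math. IHÉS 83 (1996),
  3.4–3.5, pp. 63–64.
* H. Matsumura, *Commutative Ring Theory* (1986), §32, Cor. of Thm. 32.6 (p. 260).
* A. Grothendieck, EGA IV₂, Scholie 7.8.3 (v).
-/

noncomputable section

open CategoryTheory CategoryTheory.Limits AlgebraicGeometry TopologicalSpace Topology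

namespace Literature.AlgebraicGeometry.Resolution

universe u

open IsLocalRing

/-- **de Jong 1996, 3.5, first sentence, from the G-ring property of finite type algebras over
a field**: `Matsumura1987_32_polynomial → DeJong1996CodimThreeExponentsLeOne`. If some exponent
`nnᵢ ≥ 2` in a presentation `𝒪̂_{X,x} ≅ k⟦u, v, t⟧/(uv - ∏ⱼ tⱼ^{nnⱼ})`, the prime
`(u, v, tᵢ)` of the formal model gives a non-regular local ring of dimension `≤ 2` of the
completion, hence (formal fibres of the G-ring `𝒪_{X,x}` being regular, and heights not
increasing under contraction along the flat `𝒪_{X,x} → 𝒪̂_{X,x}`) a non-regular point `x'` of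
`X` with `dim 𝒪_{X,x'} ≤ 2`, contradicting `codim(Sing(X), X) ≥ 3`.
[cite: DeJong1996, 3.5, p. 64] -/
theorem DeJong1996CodimThreeExponentsLeOne.of_polynomial (hp : Matsumura1987_32_polynomial.{u}) :
    DeJong1996CodimThreeExponentsLeOne.{u} := by
  intro k _ _ X Y f g D n τ hS hcodim m nn x hx hne i
  obtain ⟨e⟩ := hne
  by_contra hni
  have hi : 2 ≤ nn i := by omega
  -- Step 1: the singular prime of the formal model
  obtain ⟨𝔓, h𝔓, hnreg, hdim⟩ :=
    DeJong1996.exists_prime_nodalPowRing_not_isRegularLocalRing (k := k) nn i hi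
  -- Noetherian local rings of `X`
  haveI : IsNoetherian X := DeJong1996.isNoetherian_of_isProjectiveOver (f ≫ g) hS.isProjectiveOver
  haveI : LocallyOfFiniteType (f ≫ g) := hS.locallyOfFiniteType
  -- transport `𝔓` to the completion `𝒪̂_{X,x}` along `e`
  let 𝔓' : Ideal (AdicCompletion (maximalIdeal (X.presheaf.stalk x)) (X.presheaf.stalk x)) :=
    𝔓.comap e
  haveI h𝔓' : 𝔓'.IsPrime := Ideal.comap_isPrime e 𝔓
  let eloc : Localization.AtPrime 𝔓' ≃+* Localization.AtPrime 𝔓 :=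
    IsLocalization.ringEquivOfRingEquiv (Localization.AtPrime 𝔓') (Localization.AtPrime 𝔓) e
      (e.map_primeCompl_comap_eq 𝔓)
  have hnreg' : ¬ IsRegularLocalRing (Localization.AtPrime 𝔓') := fun h =>
    hnreg (IsRegularLocalRing.of_ringEquiv eloc)
  have hdim' : ringKrullDim (Localization.AtPrime 𝔓') ≤ 2 := by
    rw [ringKrullDim_eq_of_ringEquiv eloc]
    exact hdim
  -- Step 2: `𝒪_{X,x}` is a G-ring, so regularity and dimension pass to the contraction `𝔭`
  obtain ⟨U, hU, hxU, -⟩ :=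
    exists_isAffineOpen_mem_and_subset (X := X) (x := x) (U := ⊤) (Opens.mem_top x)
  have hqe := Scheme.isQuasiExcellent_of_locallyOfFiniteType_of_polynomial hp (f ≫ g)
  have hGU : IsGRing Γ(X, U) := (hqe ⟨U, hU⟩).isGRing
  letI := TopCat.Presheaf.algebra_section_stalk X.presheaf (⟨x, hxU⟩ : U)
  haveI hlocx := hU.isLocalization_stalk ⟨x, hxU⟩
  have hGA : IsGRing (X.presheaf.stalk x) :=
    isGRing_of_isLocalization (hU.primeIdealOf ⟨x, hxU⟩).asIdeal.primeCompl hGU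
  obtain ⟨hiff, hle⟩ := hGA.isRegularLocalRing_localization_adicCompletion_iff 𝔓'
  have h1 : ¬ IsRegularLocalRing
      (Localization.AtPrime (𝔓'.under (X.presheaf.stalk x))) := fun h => hnreg' (hiff.mpr h)
  have h2 : ringKrullDim (Localization.AtPrime (𝔓'.under (X.presheaf.stalk x))) ≤ 2 :=
    hle.trans hdim'
  -- Step 3: the point `x'` of `X` whose local ring is `(𝒪_{X,x})_𝔭`
  let 𝔭₀ : Ideal Γ(X, U) := (𝔓'.under (X.presheaf.stalk x)).under Γ(X, U)
  let y : PrimeSpectrum Γ(X, U) := ⟨𝔭₀, inferInstance⟩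
  have hy : (hU.fromSpec y : X) ∈ U := by
    have hr : (hU.fromSpec y : X) ∈ Set.range (hU.fromSpec : _ → X) := ⟨y, rfl⟩
    rwa [hU.range_fromSpec] at hr
  letI := TopCat.Presheaf.algebra_section_stalk X.presheaf (⟨hU.fromSpec y, hy⟩ : U)
  haveI hlocy : IsLocalization.AtPrime (X.presheaf.stalk (hU.fromSpec y)) 𝔭₀ :=
    hU.isLocalization_stalk' y hy
  haveI : IsScalarTower Γ(X, U) (X.presheaf.stalk x)
      (Localization.AtPrime (𝔓'.under (X.presheaf.stalk x))) :=
    IsScalarTower.of_algebraMap_eq' rfl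
  haveI hloc2 : IsLocalization.AtPrime
      (Localization.AtPrime (𝔓'.under (X.presheaf.stalk x))) 𝔭₀ :=
    IsLocalization.isLocalization_isLocalization_atPrime_isLocalization
      (hU.primeIdealOf ⟨x, hxU⟩).asIdeal.primeCompl
      (Localization.AtPrime (𝔓'.under (X.presheaf.stalk x))) (𝔓'.under (X.presheaf.stalk x))
  let e2 : X.presheaf.stalk (hU.fromSpec y) ≃ₐ[Γ(X, U)]
      Localization.AtPrime (𝔓'.under (X.presheaf.stalk x)) :=
    IsLocalization.algEquiv 𝔭₀.primeCompl _ _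
  have hx'nreg : ¬ IsRegularLocalRing (X.presheaf.stalk (hU.fromSpec y)) := fun h =>
    h1 (IsRegularLocalRing.of_ringEquiv e2.toRingEquiv)
  have h3 := hcodim _ hx'nreg
  rw [ringKrullDim_eq_of_ringEquiv e2.toRingEquiv] at h3
  have h32 : (3 : WithBot ℕ∞) ≤ 2 := h3.trans h2
  exact absurd h32 (by decide)

end Literature.AlgebraicGeometry.Resolution

end
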